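import Mathlib
import HarnessLib
import Summits.HubbardSuperconductivity.HubbardSuperconductivity.Theorems.KLProgrammeKLRegimeTwoVolumeLipDoorToKit

/-!
# Route `KLProgramme` — crux K3 ENGINE (stmt-HubbardSuperconductivity-20437), stub (e) proof-input «(e)-D-ROWS», F-D5c′ (i): THE WHOLE DEEP BLOCK-STEP DOOR IN
# KIT FORM — E1's dictionary applied to the right side of `…TwoVolumeLipBlockStepDeep.lipBlockStep_deep_le`
# (seat hubbard-kl-k3c4-p1 g24; `--supports` 20437; DROWS-SCOPE-g23 v7 §9.3/§9.4 F-D5c′)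

The LIP term of the (Db) row (`…TwoVolumeLipBornDiffStep{,Profile}`) is the right side of the deep block-step door: transfer rows `a`, far tail `τ`, admissible
`Λ`, Gram constant `κ`, polymer radius `ρ`, covariance rows `α`, truncation `N₀`, and the three profiles on the label type `Γ` — `NV` (glued coarse input), `ND`
(input difference, global), `E` (input difference at deep pins):
`a^{2q−1}(a(FO(E) + Λ⁻¹FO(ND)) + τFO(ND)) + a^{2q−1}(a(GL(E; NV+ND+E) + Λ⁻¹GZ_Λ(ND; NV+ND)) + τGL(ND; NV+ND))`
with `FO` the binomial first order, `GL` the graded Lipschitz bracket (mixed graded sum + `2·`tail) and `GZ_Λ` the zone bracket (mixed graded sum + `Λ·2·`tail).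
This file is pure real analysis: each bracket is replaced by its KIT image under E1's dictionary (`N := N₀ − 1`, `ψ := ρ⁻²`, `Φ := eα/κ²`, `τ_kit := (e²(κ+ρ))²`,
`σ := κ²`, degree-`0` sizes `0`, `D ≥ |Γ|/2`):
`FO(X) ≤ towerFO D κ² X q` (`…EngineTowerDoorToKitFO.doorBinomial_le_towerFO`), `GL(ν; μ) ≤ kitStepLip(ν, μ; Ct := 2)`
(`…EngineTowerDoorToKitLip.doorGradedLip_le_kitStepLip`), `GZ_Λ(ν; μ) ≤ kitStepLip(ν, μ; Ct := 2Λ)` (`…TwoVolumeLipDoorToKit.doorGradedZone_le_kitStepLip`),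
under the kit's guards `Φ·towerV(NV+ND+E) < 1`, `Φ·towerV(NV+ND) < 1` (which imply the door's own smallness `θ₁, θ₂ < 1`, `normV ≤ towerV`).

* `lipDoor_le_kit` — the displayed domination (`1 ≤ q`, `2q = n+1`, `1 ≤ Λ`, `a, τ ≥ 0`).
* `door_theta_lt_one_of_guard` — `eα·normV Γ κ ρ μ/κ² < 1` from the guard `(eα/κ²)·towerV D τ_kit μ < 1`.

Pure real analysis; nothing about the model is asserted; nothing asserts the (D) rows, stub (e), VL, K3 or superconductivity.
References: BGM 2006 §2.8 (2.86)–(2.90), §3 [cite: BenfattoGiulianiMastropietro2006]; Gawȩdzki–Kupiainen 1985 §3.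
-/

noncomputable section

namespace Summit.HubbardSuperconductivity.HubbardSuperconductivity.Theorems.TwoVolumeDefect

set_option linter.dupNamespace false -- summit = problem name (single-conjunct summit), D-0017

open Finset Literature.MathematicalPhysics.QuantumLattice
open Summit.HubbardSuperconductivity.HubbardSuperconductivity.Theorems.EngineV8

/-- **The door's smallness from the kit's guard**: `N ≥ 0`, `N 0 = 0`, `D ≥ |Γ|/2`, `(eα/κ²)·towerV D (e²(κ+ρ))² N < 1` ⇒ `eα·normV Γ κ ρ N/κ² < 1`. -/
theorem door_theta_lt_one_of_guard {Γ : Type*} [Fintype Γ] {κ ρ α : ℝ} (hκ : 0 < κ) (hρ : 0 < ρ) (hα : 0 ≤ α)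
    {N : ℕ → ℝ} (hN0 : ∀ m, 0 ≤ N m) (hN00 : N 0 = 0) {D : ℕ} (hD : Fintype.card Γ / 2 ≤ D)
    (hguard : Real.exp 1 * α / κ ^ 2 * towerV D ((Real.exp 2 * (κ + ρ)) ^ 2) N < 1) :
    Real.exp 1 * α * normV Γ κ ρ N / κ ^ 2 < 1 := by
  have hV := normV_le_towerV hκ.le hρ.le hN0 hN00 hD (κ := κ) (ρ := ρ)
  have hΦ : 0 ≤ Real.exp 1 * α / κ ^ 2 := by positivity
  calc Real.exp 1 * α * normV Γ κ ρ N / κ ^ 2 = Real.exp 1 * α / κ ^ 2 * normV Γ κ ρ N := by ring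
    _ ≤ Real.exp 1 * α / κ ^ 2 * towerV D ((Real.exp 2 * (κ + ρ)) ^ 2) N := mul_le_mul_of_nonneg_left hV hΦ
    _ < 1 := hguard

set_option maxHeartbeats 400000 in -- six dictionary applications assembled in one term
/-- **F-D5c′ (i) — the deep block-step door in kit form.**  For `κ, ρ > 0`, `α ≥ 0`, `1 ≤ Λ`, `a, τ ≥ 0`, profiles `NV, ND, E ≥ 0` with degree-`0` size `0`,
`D ≥ |Γ|/2`, `N₀ ≥ 2`, output degree `n + 1 = 2q` with `1 ≤ q`, and the kit's guards at the two majorants `NV+ND+E`, `NV+ND`: the right side of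
`lipBlockStep_deep_le` (generic in the label type `Γ`) is at most its kit image (displayed). -/
theorem lipDoor_le_kit {Γ : Type*} [Fintype Γ] {κ ρ α Λ a τ : ℝ} (hκ : 0 < κ) (hρ : 0 < ρ) (hα : 0 ≤ α) (hΛ : 1 ≤ Λ) (ha : 0 ≤ a) (hτ : 0 ≤ τ)
    {NV ND E : ℕ → ℝ} (hNV0 : ∀ m, 0 ≤ NV m) (hND0 : ∀ m, 0 ≤ ND m) (hE0 : ∀ m, 0 ≤ E m) (hNV00 : NV 0 = 0) (hND00 : ND 0 = 0) (hE00 : E 0 = 0)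
    {D : ℕ} (hD : Fintype.card Γ / 2 ≤ D) {N₀ : ℕ} (hN₀ : 2 ≤ N₀) {n q : ℕ} (hq : 2 * q = n + 1)
    (hg₁ : Real.exp 1 * α / κ ^ 2 * towerV D ((Real.exp 2 * (κ + ρ)) ^ 2) (fun m' => NV m' + ND m' + E m') < 1)
    (hg₂ : Real.exp 1 * α / κ ^ 2 * towerV D ((Real.exp 2 * (κ + ρ)) ^ 2) (fun m' => NV m' + ND m') < 1) :
      a ^ (2 * q - 1) * (a *
        ((∑ m' ∈ range (Fintype.card Γ / 2 + 1), if q < m' then ((2 * m').choose (2 * q) : ℝ) * κ ^ (2 * m' - 2 * q) * E m' else 0) +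
          Λ⁻¹ * ∑ m' ∈ range (Fintype.card Γ / 2 + 1),
            if q < m' then ((2 * m').choose (2 * q) : ℝ) * κ ^ (2 * m' - 2 * q) * ND m' else 0) +
        τ * ∑ m' ∈ range (Fintype.card Γ / 2 + 1), if q < m' then ((2 * m').choose (2 * q) : ℝ) * κ ^ (2 * m' - 2 * q) * ND m' else 0) +
      a ^ (2 * q - 1) * (a *
        ((∑ n' ∈ Ico 2 N₀, (ρ⁻¹ ^ (2 * q) * κ⁻¹ ^ (2 * (n' - 1)) * (α ^ (n' - 1) * Real.exp n')) *
            ∑ δ ∈ (Fintype.piFinset fun _ : Fin n' => range (Fintype.card Γ / 2 + 1)) with 2 * q + 2 * (n' - 1) ≤ ∑ a, 2 * δ a,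
              ∑ a, (Real.exp 2 * (κ + ρ)) ^ (2 * δ a) * E (δ a) *
                ∏ b' ∈ univ.erase a, (Real.exp 2 * (κ + ρ)) ^ (2 * δ b') * (NV (δ b') + ND (δ b') + E (δ b')) +
          2 * (ρ⁻¹ ^ (2 * q) * (Real.exp 1 * normV (Γ) κ ρ (fun m' => NV m' + ND m' + E m')) *
            (Real.exp 1 * α * normV (Γ) κ ρ (fun m' => NV m' + ND m' + E m') / κ ^ 2) ^ (N₀ - 1) /
              (1 - Real.exp 1 * α * normV (Γ) κ ρ (fun m' => NV m' + ND m' + E m') / κ ^ 2))) +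
        Λ⁻¹ * (∑ n' ∈ Ico 2 N₀, (ρ⁻¹ ^ (2 * q) * κ⁻¹ ^ (2 * (n' - 1)) * (α ^ (n' - 1) * Real.exp n')) *
            ∑ δ ∈ (Fintype.piFinset fun _ : Fin n' => range (Fintype.card Γ / 2 + 1)) with 2 * q + 2 * (n' - 1) ≤ ∑ a, 2 * δ a,
              ∑ a, (Real.exp 2 * (κ + ρ)) ^ (2 * δ a) * ND (δ a) *
                ∏ b' ∈ univ.erase a, (Real.exp 2 * (κ + ρ)) ^ (2 * δ b') * (NV (δ b') + ND (δ b')) +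
          Λ * (2 * (ρ⁻¹ ^ (2 * q) * (Real.exp 1 * normV (Γ) κ ρ (fun m' => NV m' + ND m')) *
            (Real.exp 1 * α * normV (Γ) κ ρ (fun m' => NV m' + ND m') / κ ^ 2) ^ (N₀ - 1) /
              (1 - Real.exp 1 * α * normV (Γ) κ ρ (fun m' => NV m' + ND m') / κ ^ 2))))) +
        τ * (∑ n' ∈ Ico 2 N₀, (ρ⁻¹ ^ (2 * q) * κ⁻¹ ^ (2 * (n' - 1)) * (α ^ (n' - 1) * Real.exp n')) *
            ∑ δ ∈ (Fintype.piFinset fun _ : Fin n' => range (Fintype.card Γ / 2 + 1)) with 2 * q + 2 * (n' - 1) ≤ ∑ a, 2 * δ a,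
              ∑ a, (Real.exp 2 * (κ + ρ)) ^ (2 * δ a) * ND (δ a) *
                ∏ b' ∈ univ.erase a, (Real.exp 2 * (κ + ρ)) ^ (2 * δ b') * (NV (δ b') + ND (δ b')) +
          2 * (ρ⁻¹ ^ (2 * q) * (Real.exp 1 * normV (Γ) κ ρ (fun m' => NV m' + ND m')) *
            (Real.exp 1 * α * normV (Γ) κ ρ (fun m' => NV m' + ND m') / κ ^ 2) ^ (N₀ - 1) /
              (1 - Real.exp 1 * α * normV (Γ) κ ρ (fun m' => NV m' + ND m') / κ ^ 2)))) ≤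
      a ^ (2 * q - 1) * (a * (towerFO D (κ ^ 2) E q + Λ⁻¹ * towerFO D (κ ^ 2) ND q) + τ * towerFO D (κ ^ 2) ND q) +
      a ^ (2 * q - 1) * (a *
        (((∑ n' ∈ Icc 2 (N₀ - 1), Real.exp 1 * (Real.exp 1 * α / κ ^ 2) ^ (n' - 1) * (ρ⁻¹ ^ 2) ^ q *
              towerSLip D ((Real.exp 2 * (κ + ρ)) ^ 2) E (fun m' => NV m' + ND m' + E m') n' q) +
            2 * ((ρ⁻¹ ^ 2) ^ q * Real.exp 1 * towerV D ((Real.exp 2 * (κ + ρ)) ^ 2) (fun m' => NV m' + ND m' + E m') *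
              (Real.exp 1 * α / κ ^ 2 * towerV D ((Real.exp 2 * (κ + ρ)) ^ 2) (fun m' => NV m' + ND m' + E m')) ^ (N₀ - 1) /
              (1 - Real.exp 1 * α / κ ^ 2 * towerV D ((Real.exp 2 * (κ + ρ)) ^ 2) (fun m' => NV m' + ND m' + E m')))) +
          Λ⁻¹ * ((∑ n' ∈ Icc 2 (N₀ - 1), Real.exp 1 * (Real.exp 1 * α / κ ^ 2) ^ (n' - 1) * (ρ⁻¹ ^ 2) ^ q *
              towerSLip D ((Real.exp 2 * (κ + ρ)) ^ 2) ND (fun m' => NV m' + ND m') n' q) +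
            (2 * Λ) * ((ρ⁻¹ ^ 2) ^ q * Real.exp 1 * towerV D ((Real.exp 2 * (κ + ρ)) ^ 2) (fun m' => NV m' + ND m') *
              (Real.exp 1 * α / κ ^ 2 * towerV D ((Real.exp 2 * (κ + ρ)) ^ 2) (fun m' => NV m' + ND m')) ^ (N₀ - 1) /
              (1 - Real.exp 1 * α / κ ^ 2 * towerV D ((Real.exp 2 * (κ + ρ)) ^ 2) (fun m' => NV m' + ND m'))))) +
        τ * ((∑ n' ∈ Icc 2 (N₀ - 1), Real.exp 1 * (Real.exp 1 * α / κ ^ 2) ^ (n' - 1) * (ρ⁻¹ ^ 2) ^ q *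
              towerSLip D ((Real.exp 2 * (κ + ρ)) ^ 2) ND (fun m' => NV m' + ND m') n' q) +
            2 * ((ρ⁻¹ ^ 2) ^ q * Real.exp 1 * towerV D ((Real.exp 2 * (κ + ρ)) ^ 2) (fun m' => NV m' + ND m') *
              (Real.exp 1 * α / κ ^ 2 * towerV D ((Real.exp 2 * (κ + ρ)) ^ 2) (fun m' => NV m' + ND m')) ^ (N₀ - 1) /
              (1 - Real.exp 1 * α / κ ^ 2 * towerV D ((Real.exp 2 * (κ + ρ)) ^ 2) (fun m' => NV m' + ND m'))))) := by
  obtain ⟨q', rfl⟩ : ∃ q', q = q' + 1 := ⟨q - 1, by omega⟩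
  have hq' : n + 1 = 2 * (q' + 1) := hq.symm
  have hΛ0 : 0 < Λ := one_pos.trans_le hΛ
  have hΛi : 0 ≤ Λ⁻¹ := inv_nonneg.2 hΛ0.le
  have ha' : 0 ≤ a ^ (2 * (q' + 1) - 1) := pow_nonneg ha _
  have hμ₁0 : ∀ m, 0 ≤ (fun m' => NV m' + ND m' + E m') m := fun m => add_nonneg (add_nonneg (hNV0 m) (hND0 m)) (hE0 m)
  have hμ₁00 : (fun m' => NV m' + ND m' + E m') 0 = 0 := by simp only [hNV00, hND00, hE00, add_zero]
  have hμ₂0 : ∀ m, 0 ≤ (fun m' => NV m' + ND m') m := fun m => add_nonneg (hNV0 m) (hND0 m)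
  have hμ₂00 : (fun m' => NV m' + ND m') 0 = 0 := by simp only [hNV00, hND00, add_zero]
  -- first orders
  have hFOE := doorBinomial_le_towerFO (D := D) hκ.le hE0 hD q'
  have hFOD := doorBinomial_le_towerFO (D := D) hκ.le hND0 hD q'
  -- graded brackets
  have hGLE := doorGradedLip_le_kitStepLip (Γ := Γ) hκ hρ hα hμ₁0 hμ₁00 hE0 hE00 hD hN₀ hq' hg₁
  have hGZD := doorGradedZone_le_kitStepLip (Γ := Γ) hκ hρ hα hΛ hμ₂0 hμ₂00 hND0 hND00 hD hN₀ hq' hg₂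
  have hGLD := doorGradedLip_le_kitStepLip (Γ := Γ) hκ hρ hα hμ₂0 hμ₂00 hND0 hND00 hD hN₀ hq' hg₂
  rw [hq'] at hGLE hGZD hGLD
  exact add_le_add
    (mul_le_mul_of_nonneg_left (add_le_add (mul_le_mul_of_nonneg_left (add_le_add hFOE (mul_le_mul_of_nonneg_left hFOD hΛi)) ha)
      (mul_le_mul_of_nonneg_left hFOD hτ)) ha')
    (mul_le_mul_of_nonneg_left (add_le_add (mul_le_mul_of_nonneg_left (add_le_add hGLE (mul_le_mul_of_nonneg_left hGZD hΛi)) ha)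
      (mul_le_mul_of_nonneg_left hGLD hτ)) ha')

end Summit.HubbardSuperconductivity.HubbardSuperconductivity.Theorems.TwoVolumeDefect

end
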